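import Summits.Ventures.AbcSig.Rows.Bridge
import Summits.Ventures.AbcSig.Rows.C2aL311A6
import Summits.Ventures.AbcSig.Rows.C2aL311A6AB

/-!
# Venture AbcSig — CELL `C2aL311A6`: the census statement `Rows.C2aCellRed 311 (fun a => 6 ≤ a) ∅` from the two row theorems

HONEST FRAMING. COMPUTATION cell `pub-abcsig`; CONDITIONAL theorem; no claim on ABC or any summit. Hypotheses exactly as in
`Rows/C2aL311A6.lean` / `Rows/C2aL311A6AB.lean` (BS04Package CITED; DataComplete / RefinesCPSymAll / Refines COMPUTED; EisPackage CITED; the rows'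
per-orbit CITED exclusions for both family predicates, primed names for `famAB`). Row of record
`census/rows/C2a/C2a-l311-a6plus.md` (sha16 `403fa91909d1d74c`). GENERATED by p-lean g4 `gen4/a6row.py` (pattern of `Rows/C2aL307A6XCell.lean`).
-/

namespace Summit.Ventures.AbcSig

/-- Cell `C2aL311A6`: `Rows.C2aCellRed 311 (fun a => 6 ≤ a) ∅` under the rows' hypotheses. -/
theorem xcell_C2aL311A6 (M : NewformModel) (hP : M.BS04Package)
    (hE : M.EisPackage)
    (hR_orbit_622_4 : M.Refines 622 orbit_622_4 m6X_622_4)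
    (hD311 : M.DataComplete 311 level311Orbits) (hCP311 : M.RefinesCPSymAll 311 level311CP)
    (hD622 : M.DataComplete 622 level622Orbits)
    (hX_orbit_311_2 : ∀ n a m : ℕ, n ∈ ([31] : List ℕ) → M.Excludes 311 orbit_311_2 (famB (2 ^ a * 311 ^ m) n (fun _ _ => True)))
    (hX_orbit_311_2' : ∀ n a m : ℕ, n ∈ ([31] : List ℕ) → M.Excludes 311 orbit_311_2 (famAB (311 ^ m) (2 ^ a) n (fun _ _ => True))) :
    Rows.C2aCellRed 311 (fun a => 6 ≤ a) ∅ :=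
  C2aCellRed_of_rows 311 (by norm_num) (by norm_num) _ _
    (fun n hn h11 hnℓ _ a m ha han hm hmn x y z h1 h2 =>
      xrow_C2aL311A6 M hP hE hR_orbit_622_4 hD311 hCP311 hD622 n hn h11 hnℓ  a m ha hm han hmn (hX_orbit_311_2 n a m) x y z h1 h2)
    (fun n hn h11 hnℓ _ a m ha han hm hmn x y z h1 h2 =>
      xrow_C2aL311A6AB M hP hE hR_orbit_622_4 hD311 hCP311 hD622 n hn h11 hnℓ  a m ha hm han hmn (hX_orbit_311_2' n a m) x y z h1 h2)

end Summit.Ventures.AbcSig
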